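import Mathlib
import Summits.Ventures.PercRepro2.TwoSumPacking
import Summits.Ventures.PercRepro2.ParallelPair

/-!
# 2-sums with a piece of packing number ≤ 2: the capacity-2 transfer lemma
(seat mine-b, cell pub-perc-repro2; conjectures/MINE-B.md §13.3)

The base `A₁` carries a parallel pair `p₁, p₂` (ParallelPair.lean); the 2-sum with a piece `A₂` is
formed at `p₁` after deleting `p₂` (`del A₁ p₂`), so it is the 2-sum of the single-copy base
(`twoSum_del_eq`).  **Capacity-2 transfer** (`kDisj_twoSum₂_iff`): if the piece has packing number
≤ 2 (`∀ S, ¬ DOcc A₂ (DOcc A₂ A₂) S`), then `k` disjoint witnesses of the 2-sum in `X` are the same as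
`k` disjoint witnesses of the doubled base `A₁` in the capacity-2 left configuration `leftCfg₂ X` — the
left part of `X` with as many copies of `p` as the piece packs in the right part.  The couplings are
those of TwoSumPacking.lean, lifts and descents, with the swap `p₁ ↔ p₂` handing the second copy to
the second witness (three witnesses through the pair would pack `A₂` three times).  With this, the
composite count of a 2-sum with a packing-2 piece is a combination of the capacitated counts of the
doubled base — the input of the absorption lemma (TwoSumAbsorb.lean).
-/

open Finset

namespace Summit.Ventures.PercRepro2

namespace StepZero

open ReimerCube

variable {E₁ E₂ : Type*} [DecidableEq E₁]

section Cap2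

variable {A₂ : Finset E₂ → Prop} {p₁ p₂ : E₁}

open Classical

/-- the composite event of the 2-sum at `p₁` of the single-copy base `del A₁ p₂` -/
lemma twoSum_del_eq (A₁ : Finset E₁ → Prop) (hne : p₁ ≠ p₂) (X : Finset (E₁ ⊕ E₂)) :
    twoSum (del A₁ p₂) A₂ p₁ X
      ↔ A₁ ((X.toLeft.erase p₁).erase p₂ ∪ (if A₂ X.toRight then {p₁} else ∅)) := by
  unfold twoSum del leftCfg
  rw [Finset.erase_union_distrib]
  by_cases h : A₂ X.toRight
  · simp only [h, if_true]
    rw [Finset.erase_eq_of_notMem (s := ({p₁} : Finset E₁)) (by simp [hne.symm])]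
  · simp [h]

/-- **Capacity-2 transfer.**  For a piece of packing number ≤ 2 and a base with a parallel pair
`p₁, p₂`, the packings of the 2-sum (formed at `p₁` on the single-copy base) are the packings of the
doubled base on the capacity-2 left configuration. -/
theorem kDisj_twoSum₂_iff {A₁ : Finset E₁ → Prop} (hpar : IsParallel A₁ p₁ p₂) (hA₁ : Incr A₁)
    (hA₂ : Incr A₂) (h₂ : ∀ S, ¬ DOcc A₂ (DOcc A₂ A₂) S) :
    ∀ (k : ℕ) (X : Finset (E₁ ⊕ E₂)),
      kDisj (twoSum (del A₁ p₂) A₂ p₁) k X ↔ kDisj A₁ k (leftCfg₂ A₂ p₁ p₂ X)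
  | 0, X => by simp [kDisj]
  | k + 1, X => by
    have hne := hpar.ne
    constructor
    · rintro ⟨K, L, hK, hL, hKL, hAK, hAL⟩
      -- the copy handed to `K`: `p₂` if `L` also uses the piece, else `p₁`
      by_cases uK : A₂ K.toRight
      · -- `K` uses the piece
        have hKw : ∀ T, K.toRight ⊆ T → A₂ T := fun T hT => hA₂ hT uK
        have hRdisj : Disjoint K.toRight L.toRight := by
          rw [Finset.disjoint_left]
          intro y hyK hyL
          exact Finset.disjoint_left.mp hKL (Finset.mem_toRight.mp hyK) (Finset.mem_toRight.mp hyL)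
        -- `L` cannot pack `A₂` twice (three disjoint witnesses)
        have hLnot2 : ¬ DOcc A₂ A₂ L.toRight := by
          intro h2
          apply h₂ (K.toRight ∪ L.toRight)
          exact ⟨K.toRight, L.toRight, Finset.subset_union_left, Finset.subset_union_right, hRdisj,
            hKw, fun T hT => incr_dOcc A₂ A₂ hT h2⟩
        by_cases uL : A₂ L.toRight
        · -- both use the piece: `K` takes `p₂`, `L` takes `p₁`
          have hX2 : DOcc A₂ A₂ X.toRight :=
            ⟨K.toRight, L.toRight, Finset.toRight_subset_toRight hK, Finset.toRight_subset_toRight hL,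
              hRdisj, hKw, fun T hT => hA₂ hT uL⟩
          refine ⟨insert p₂ ((K.toLeft.erase p₁).erase p₂), leftCfg₂ A₂ p₁ p₂ L, ?_,
            leftCfg₂_mono hA₂ hL, ?_, ?_, ?_⟩
          · -- inside the left configuration of `X`
            intro x hx
            rw [Finset.mem_insert] at hx
            unfold leftCfg₂
            rcases hx with rfl | hx
            · exact Finset.mem_union_right _ (mem_copies₂.mpr (Or.inr ⟨rfl, hX2⟩))
            · exact Finset.mem_union_left _
                (Finset.erase_subset_erase _ (Finset.erase_subset_erase _ (Finset.toLeft_subset_toLeft hK)) hx)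
          · -- disjoint
            rw [Finset.disjoint_left]
            intro x hxK hxL
            rw [Finset.mem_insert] at hxK
            rcases hxK with rfl | hxK
            · exact hLnot2 (dOcc_of_mem_leftCfg₂ hne hxL)
            · rw [Finset.mem_erase, Finset.mem_erase] at hxK
              have := mem_toLeft_of_mem_leftCfg₂ hxL hxK.2.1 hxK.1
              exact Finset.disjoint_left.mp hKL (Finset.mem_toLeft.mp hxK.2.2) (Finset.mem_toLeft.mp this)
          · -- the cylinder over `K*` lies in `A₁` (lift, then swap `p₁ ↦ p₂`)
            intro T hT
            have h1 := hAK _ (subset_lift (K := K) T)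
            rw [twoSum_del_eq A₁ hne] at h1
            simp only [Finset.toLeft_disjSum, Finset.toRight_disjSum, uK, if_true] at h1
            have hT2 : p₂ ∈ T := hT (Finset.mem_insert_self _ _)
            set S := (T.erase p₁).erase p₂ with hS
            have hS1 : p₁ ∉ S := fun h => (Finset.mem_erase.mp (Finset.mem_of_mem_erase h)).1 rfl
            have hS2 : p₂ ∉ S := fun h => (Finset.mem_erase.mp h).1 rfl
            have hsub : ((T ∪ K.toLeft).erase p₁).erase p₂ ∪ {p₁} ⊆ insert p₁ S := by
              intro x hx
              rw [Finset.mem_union, Finset.mem_singleton] at hx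
              rw [Finset.mem_insert]
              rcases hx with hx | rfl
              · right
                rw [Finset.mem_erase, Finset.mem_erase, Finset.mem_union] at hx
                rw [hS, Finset.mem_erase, Finset.mem_erase]
                refine ⟨hx.1, hx.2.1, ?_⟩
                rcases hx.2.2 with h | h
                · exact h
                · exact hT (Finset.mem_insert_of_mem (Finset.mem_erase.mpr ⟨hx.1, Finset.mem_erase.mpr ⟨hx.2.1, h⟩⟩))
              · left; rfl
            have h2 : A₁ (insert p₁ S) := hA₁ hsub h1
            have h3 : A₁ (insert p₂ S) := by
              apply hpar.swap
              rw [image_swap₂_insert' p₁ p₂ hne hS1 hS2]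
              exact h2
            apply hA₁ _ h3
            intro x hx
            rw [Finset.mem_insert] at hx
            rcases hx with rfl | hx
            · exact hT2
            · exact Finset.mem_of_mem_erase (Finset.mem_of_mem_erase hx)
          · -- the cylinder over `leftCfg₂ L` lies in `kDisj A₁ k`
            intro T hT
            have := (kDisj_twoSum₂_iff hpar hA₁ hA₂ h₂ k _).mp (hAL _ (subset_lift (K := L) T))
            exact incr_kDisj A₁ k (leftCfg₂_lift_subset hT) this
        · -- only `K` uses the piece: `K` takes `p₁`
          have hX1 : A₂ X.toRight := hA₂ (Finset.toRight_subset_toRight hK) uK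
          refine ⟨insert p₁ ((K.toLeft.erase p₁).erase p₂), leftCfg₂ A₂ p₁ p₂ L, ?_,
            leftCfg₂_mono hA₂ hL, ?_, ?_, ?_⟩
          · intro x hx
            rw [Finset.mem_insert] at hx
            unfold leftCfg₂
            rcases hx with rfl | hx
            · exact Finset.mem_union_right _ (mem_copies₂.mpr (Or.inl ⟨rfl, hX1⟩))
            · exact Finset.mem_union_left _
                (Finset.erase_subset_erase _ (Finset.erase_subset_erase _ (Finset.toLeft_subset_toLeft hK)) hx)
          · rw [Finset.disjoint_left]
            intro x hxK hxL
            rw [Finset.mem_insert] at hxK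
            rcases hxK with rfl | hxK
            · exact uL (A₂_of_mem_leftCfg₂ hxL (Or.inl rfl))
            · rw [Finset.mem_erase, Finset.mem_erase] at hxK
              have := mem_toLeft_of_mem_leftCfg₂ hxL hxK.2.1 hxK.1
              exact Finset.disjoint_left.mp hKL (Finset.mem_toLeft.mp hxK.2.2) (Finset.mem_toLeft.mp this)
          · intro T hT
            have h1 := hAK _ (subset_lift (K := K) T)
            rw [twoSum_del_eq A₁ hne] at h1
            simp only [Finset.toLeft_disjSum, Finset.toRight_disjSum, uK, if_true] at h1
            apply hA₁ _ h1
            intro x hx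
            rw [Finset.mem_union, Finset.mem_singleton] at hx
            rcases hx with hx | rfl
            · rw [Finset.mem_erase, Finset.mem_erase, Finset.mem_union] at hx
              rcases hx.2.2 with h | h
              · exact h
              · exact hT (Finset.mem_insert_of_mem (Finset.mem_erase.mpr ⟨hx.1, Finset.mem_erase.mpr ⟨hx.2.1, h⟩⟩))
            · exact hT (Finset.mem_insert_self _ _)
          · intro T hT
            have := (kDisj_twoSum₂_iff hpar hA₁ hA₂ h₂ k _).mp (hAL _ (subset_lift (K := L) T))
            exact incr_kDisj A₁ k (leftCfg₂_lift_subset hT) this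
      · -- `K` does not use the piece
        refine ⟨(K.toLeft.erase p₁).erase p₂, leftCfg₂ A₂ p₁ p₂ L, ?_, leftCfg₂_mono hA₂ hL, ?_, ?_, ?_⟩
        · intro x hx
          unfold leftCfg₂
          exact Finset.mem_union_left _
            (Finset.erase_subset_erase _ (Finset.erase_subset_erase _ (Finset.toLeft_subset_toLeft hK)) hx)
        · rw [Finset.disjoint_left]
          intro x hxK hxL
          rw [Finset.mem_erase, Finset.mem_erase] at hxK
          have := mem_toLeft_of_mem_leftCfg₂ hxL hxK.2.1 hxK.1
          exact Finset.disjoint_left.mp hKL (Finset.mem_toLeft.mp hxK.2.2) (Finset.mem_toLeft.mp this)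
        · intro T hT
          have h1 := hAK _ (subset_lift (K := K) T)
          rw [twoSum_del_eq A₁ hne] at h1
          simp only [Finset.toLeft_disjSum, Finset.toRight_disjSum, uK, if_false, Finset.union_empty] at h1
          apply hA₁ _ h1
          intro x hx
          rw [Finset.mem_erase, Finset.mem_erase, Finset.mem_union] at hx
          rcases hx.2.2 with h | h
          · exact h
          · exact hT (Finset.mem_erase.mpr ⟨hx.1, Finset.mem_erase.mpr ⟨hx.2.1, h⟩⟩)
        · intro T hT
          have := (kDisj_twoSum₂_iff hpar hA₁ hA₂ h₂ k _).mp (hAL _ (subset_lift (K := L) T))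
          exact incr_kDisj A₁ k (leftCfg₂_lift_subset hT) this
    · rintro ⟨K', L', hK', hL', hKL', hAK', hAL'⟩
      set K₀ := (K'.erase p₁).erase p₂ with hK₀
      have hK₀X : K₀ ⊆ X.toLeft := trace_subset_toLeft hK'
      -- the composite witness built from `K'`: its trace, with a right part `Z` when it uses a copy
      have mkK : ∀ Z : Finset E₂, Z ⊆ X.toRight → (p₁ ∈ K' ∨ p₂ ∈ K') → (∀ T, Z ⊆ T → A₂ T) →
          ∀ T, K₀.disjSum Z ⊆ T → twoSum (del A₁ p₂) A₂ p₁ T := by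
        intro Z _ hcopy hZ T hT
        rw [Finset.disjSum_subset] at hT
        rw [twoSum_del_eq A₁ hne]
        have hA2T : A₂ T.toRight := hZ _ hT.2
        simp only [hA2T, if_true]
        apply witness_normalise hpar hAK' hcopy
        intro x hx
        rw [Finset.mem_insert] at hx
        rw [Finset.mem_union, Finset.mem_singleton]
        rcases hx with rfl | hx
        · right; rfl
        · left
          rw [Finset.mem_erase, Finset.mem_erase] at hx ⊢
          exact ⟨hx.1, hx.2.1, hT.1 (Finset.mem_erase.mpr ⟨hx.1, Finset.mem_erase.mpr ⟨hx.2.1, hx.2.2⟩⟩)⟩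
      by_cases hKc : p₁ ∈ K' ∨ p₂ ∈ K'
      · have hA2X : A₂ X.toRight := by
          rcases hKc with h | h
          · exact A₂_of_mem_leftCfg₂ (hK' h) (Or.inl rfl)
          · exact A₂_of_mem_leftCfg₂ (hK' h) (Or.inr rfl)
        by_cases hLc : p₁ ∈ L' ∨ p₂ ∈ L'
        · -- both use a copy: two disjoint witnesses of `A₂` in the right part
          have hX2 : DOcc A₂ A₂ X.toRight := by
            rcases hKc with h | h <;> rcases hLc with h' | h'
            · exact absurd h' (Finset.disjoint_left.mp hKL' h)
            · exact dOcc_of_mem_leftCfg₂ hne (hL' h')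
            · exact dOcc_of_mem_leftCfg₂ hne (hK' h)
            · exact absurd h' (Finset.disjoint_left.mp hKL' h)
          obtain ⟨Z₁, Z₂, hZ₁, hZ₂, hZ, hA1, hA2⟩ := hX2
          refine ⟨K₀.disjSum Z₁, (X.toLeft \ K₀).disjSum (X.toRight \ Z₁), ?_, ?_, ?_,
            mkK Z₁ hZ₁ hKc hA1, ?_⟩
          · rw [Finset.disjSum_subset]; exact ⟨hK₀X, hZ₁⟩
          · rw [Finset.disjSum_subset]; exact ⟨Finset.sdiff_subset, Finset.sdiff_subset⟩
          · rw [Finset.disjoint_left]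
            rintro (x | y) hx hy
            · rw [Finset.inl_mem_disjSum] at hx hy
              exact (Finset.mem_sdiff.mp hy).2 hx
            · rw [Finset.inr_mem_disjSum] at hx hy
              exact (Finset.mem_sdiff.mp hy).2 hx
          · intro T hT
            apply incr_kDisj _ k hT
            rw [kDisj_twoSum₂_iff hpar hA₁ hA₂ h₂ k, leftCfg₂_disjSum]
            have hA2' : A₂ (X.toRight \ Z₁) := hA2 _ (by
              intro y hy; exact Finset.mem_sdiff.mpr ⟨hZ₂ hy, fun h => Finset.disjoint_left.mp hZ h hy⟩)
            have hp₁ : p₁ ∈ copies₂ A₂ p₁ p₂ (X.toRight \ Z₁) := mem_copies₂.mpr (Or.inl ⟨rfl, hA2'⟩)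
            -- `L'` holds exactly one copy; rename it to `p₁` if it is `p₂`
            have hL'sub : ∀ x ∈ L', x ≠ p₁ → x ≠ p₂ → x ∈ (X.toLeft \ K₀) := by
              intro x hx h1 h2
              rw [Finset.mem_sdiff]
              refine ⟨mem_toLeft_of_mem_leftCfg₂ (hL' hx) h1 h2, fun hK => ?_⟩
              exact Finset.disjoint_left.mp hKL' (Finset.mem_of_mem_erase (Finset.mem_of_mem_erase hK)) hx
            have hL'p₂ : p₂ ∈ L' → p₁ ∉ L' := by
              intro h2 h1
              rcases hKc with h | h
              · exact Finset.disjoint_left.mp hKL' h h1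
              · exact Finset.disjoint_left.mp hKL' h h2
            by_cases hL1 : p₁ ∈ L'
            · apply hAL'
              intro x hx
              rw [Finset.mem_union]
              by_cases hx1 : x = p₁
              · subst hx1; exact Or.inr hp₁
              · by_cases hx2 : x = p₂
                · subst hx2
                  exfalso
                  rcases hKc with h | h
                  · exact Finset.disjoint_left.mp hKL' h hL1
                  · exact Finset.disjoint_left.mp hKL' h hx
                · left
                  rw [Finset.mem_erase, Finset.mem_erase]
                  exact ⟨hx2, hx1, hL'sub x hx hx1 hx2⟩
            · have hL2 : p₂ ∈ L' := hLc.resolve_left hL1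
              apply witness_kDisj_swap hpar k hAL'
              intro x hx
              rw [mem_image_swap₂] at hx
              rw [Finset.mem_union]
              by_cases hx1 : x = p₁
              · subst hx1; exact Or.inr hp₁
              · by_cases hx2 : x = p₂
                · subst hx2
                  rw [swap₂_right _ _ hne] at hx
                  exact absurd hx hL1
                · rw [swap₂_of_ne _ _ _ hx1 hx2] at hx
                  left
                  rw [Finset.mem_erase, Finset.mem_erase]
                  exact ⟨hx2, hx1, hL'sub x hx hx1 hx2⟩
        · -- only `K'` uses a copy: `K` takes the whole right part
          rw [not_or] at hLc
          refine ⟨K₀.disjSum X.toRight, (X.toLeft \ K₀).disjSum ∅, ?_, ?_, ?_,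
            mkK X.toRight le_rfl hKc (fun T hT => hA₂ hT hA2X), ?_⟩
          · rw [Finset.disjSum_subset]; exact ⟨hK₀X, le_rfl⟩
          · rw [Finset.disjSum_subset]; exact ⟨Finset.sdiff_subset, Finset.empty_subset _⟩
          · rw [Finset.disjoint_left]
            rintro (x | y) hx hy
            · rw [Finset.inl_mem_disjSum] at hx hy
              exact (Finset.mem_sdiff.mp hy).2 hx
            · rw [Finset.inr_mem_disjSum] at hy
              exact absurd hy (Finset.notMem_empty _)
          · intro T hT
            apply incr_kDisj _ k hT
            rw [kDisj_twoSum₂_iff hpar hA₁ hA₂ h₂ k, leftCfg₂_disjSum]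
            apply hAL'
            intro x hx
            have hx1 : x ≠ p₁ := fun h => hLc.1 (h ▸ hx)
            have hx2 : x ≠ p₂ := fun h => hLc.2 (h ▸ hx)
            apply Finset.mem_union_left
            rw [Finset.mem_erase, Finset.mem_erase, Finset.mem_sdiff]
            refine ⟨hx2, hx1, mem_toLeft_of_mem_leftCfg₂ (hL' hx) hx1 hx2, fun hK => ?_⟩
            exact Finset.disjoint_left.mp hKL' (Finset.mem_of_mem_erase (Finset.mem_of_mem_erase hK)) hx
      · -- `K'` uses no copy
        rw [not_or] at hKc
        have hK'X : K' ⊆ X.toLeft := by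
          intro x hx
          exact mem_toLeft_of_mem_leftCfg₂ (hK' hx) (fun h => hKc.1 (h ▸ hx)) (fun h => hKc.2 (h ▸ hx))
        refine ⟨K'.disjSum ∅, (X.toLeft \ K').disjSum X.toRight, ?_, ?_, ?_, ?_, ?_⟩
        · rw [Finset.disjSum_subset]; exact ⟨hK'X, Finset.empty_subset _⟩
        · rw [Finset.disjSum_subset]; exact ⟨Finset.sdiff_subset, le_rfl⟩
        · rw [Finset.disjoint_left]
          rintro (x | y) hx hy
          · rw [Finset.inl_mem_disjSum] at hx hy
            exact (Finset.mem_sdiff.mp hy).2 hx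
          · rw [Finset.inr_mem_disjSum] at hx
            exact absurd hx (Finset.notMem_empty _)
        · intro T hT
          rw [Finset.disjSum_subset] at hT
          rw [twoSum_del_eq A₁ hne]
          apply hAK'
          intro x hx
          apply Finset.mem_union_left
          rw [Finset.mem_erase, Finset.mem_erase]
          exact ⟨fun h => hKc.2 (h ▸ hx), fun h => hKc.1 (h ▸ hx), hT.1 hx⟩
        · intro T hT
          apply incr_kDisj _ k hT
          rw [kDisj_twoSum₂_iff hpar hA₁ hA₂ h₂ k, leftCfg₂_disjSum]
          apply hAL'
          intro x hx
          rw [Finset.mem_union]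
          by_cases hx1 : x = p₁
          · subst hx1
            exact Or.inr (mem_copies₂.mpr (Or.inl ⟨rfl, A₂_of_mem_leftCfg₂ (hL' hx) (Or.inl rfl)⟩))
          · by_cases hx2 : x = p₂
            · subst hx2
              exact Or.inr (mem_copies₂.mpr (Or.inr ⟨rfl, dOcc_of_mem_leftCfg₂ hne (hL' hx)⟩))
            · left
              rw [Finset.mem_erase, Finset.mem_erase, Finset.mem_sdiff]
              exact ⟨hx2, hx1, mem_toLeft_of_mem_leftCfg₂ (hL' hx) hx1 hx2,
                fun hK => Finset.disjoint_left.mp hKL' hK hx⟩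

end Cap2

end StepZero

end Summit.Ventures.PercRepro2
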